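import Summits.BirchSwinnertonDyer.BirchSwinnertonDyer.Theorems.GenusKolyvaginAtTwoGenusPrimitiveSupplyAtTwoArchimedeanEgg
import Summits.BirchSwinnertonDyer.BirchSwinnertonDyer.Theorems.GenusKolyvaginAtTwoGenusPrimitiveSupplyAtTwoDualityDischarged
import HarnessLib

/-!
# Route `GenusKolyvaginAtTwo`, crux #2 `GenusPrimitiveSupplyAtTwo` (stmt-BirchSwinnertonDyer-22136):
# the last member of the `-desc` packet — T-C `F1Sign2.EggTwistLawAtTwo`: the DOWN conjunct UNCONDITIONALLY in T-C's own
# hypotheses, both conjuncts on the habitat modulo {Kramer parity}; `ε(W) = +1 ⟺ E(ℚ)` meets the egg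

Width seat `bsd-line-gk2-p5` g10 (cell `bsd-f1-sign2`, SUPPLY lineage), file 31 of the series (sequel of
`…ArchimedeanEgg.lean`). THEOREMS ONLY (no definition, no named fact, no `sorry`, no local instance); helper
`--supports stmt-BirchSwinnertonDyer-22136`; no item is closed; BSD is not proved by any of this.

WHAT. With file 30's dictionary («`E(ℚ)` meets the egg ⟺ some class of `Sel₂(W)` is non-trivial at `∞`», for `Δ > 0`, `E(ℚ)[2] = 0`,
`Ш(W)[2] = 0`) and `#Sel₂(W) = 2` (rank one), the level law of file 27 (DOWN `2·#Sel₂(W^{(d)}) = #Sel₂(W)` from a class non-trivial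
at `∞`, modulo {PT, Tate χ}; UP `#Sel₂(W^{(d)}) = 2·#Sel₂(W)` from strictness at `∞`, on the habitat modulo {PT, Tate χ, Kramer
parity}) gives the cell's T-C:

* §75 **`eggTwistLaw_meetsEgg` — T-C's DOWN conjunct `MeetsEgg W → #Sel₂(W^{(d)}) = 1` under EXACTLY T-C's hypotheses (`W` globally
  minimal, `Δ_W > 0`, `NoRationalTwoTorsion W`, rank `1`, `ShaTwoTrivial W`, `DescAdmissible W d`), UNCONDITIONAL**: Poitou–Tate and
  Tate's local Euler characteristic are fed by the tree theorems `poitouTate_selmerStructure_duality_real_holds` (every number field)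
  and `GenusKolyLowering.localEP` (lead gk2-p1 g9, p636890); no parity, no image hypothesis — the descent-admissible twists of a rank-one
  curve whose generator meets the egg have trivial `Sel₂` (rank `0`, `Ш[2] = 0`);
* **`eggTwistLaw_not_meetsEgg_habitat_of_parity` — T-C's UP conjunct `¬ MeetsEgg W → #Sel₂(W^{(d)}) = 4` ON THE HABITAT (`ρ̄_{W,2}` onto)
  modulo `MazurRubin2010.kramerParity ℚ` ONLY**; `eggTwistLaw_habitat_of_parity` — both conjuncts, T-C's conclusion verbatim;
* §76 `not_descentSignNeg_iff_meetsEgg_habitat_of_parity` — **`ε(W) = +1 ⟺ E(ℚ)` meets the egg** (habitat, `Δ > 0`, `Ш[2] = 0`,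
  modulo {Kramer parity}): the cell's descent sign, defined through twists (file 29: = strictness at `∞`), is the real component of the
  Mordell–Weil group, as -desc's census reads it (ε via twists = ε via generators, 714/714).

T-C BY NAME (`EggTwistLawAtTwo`, hypothesis `NoRationalTwoTorsion` only) stays out of reach exactly as T-A does: its UP conjunct at
image-`C₃` curves needs Kramer's congruence for the canonical twist identification, which the typed `kramerParity` (binder `huniq`)
does not supply there; its DOWN conjunct is `eggTwistLaw_meetsEgg` for every `W`.

References: [Kramer1981] §2 Prop. 6, Thm. 1; [MazurRubin2010] Thm. 2.7, Lemma 2.9, Prop. 3.3, Cor. 3.4 (i); [MilneADT2006] I Thm. 2.8,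
2.13, 4.10; [BrumerKramer1977] Prop. 3.7.
-/

set_option linter.dupNamespace false -- tree convention: `Summit.BirchSwinnertonDyer.BirchSwinnertonDyer.Theorems` (summit = sub-problem)
set_option autoImplicit false

noncomputable section

open scoped Classical ContRepresentation

namespace Summit.BirchSwinnertonDyer.BirchSwinnertonDyer.Theorems.GenusKolyArch

open WeierstrassCurve Field NumberField IsDedekindDomain Function
open Literature.NumberTheory.EllipticCurves Literature.NumberTheory.GaloisRepresentations
open Literature.NumberTheory.GaloisCohomology
open Summit.BirchSwinnertonDyer.Rank1Residual.F1Sign2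
open Summit.BirchSwinnertonDyer.BirchSwinnertonDyer.Theorems.SchneiderFreeAdditiveX3.PoitouTateReduction
  (poitouTate_selmerStructure_duality_real_holds)
open Summit.BirchSwinnertonDyer.BirchSwinnertonDyer.Theorems.GenusKolyTwin (noRationalTwoTorsion_of_hasSurjectiveModNGaloisRep)

variable (W : WeierstrassCurve ℚ) [W.IsElliptic] [W.IsGloballyMinimal]

/-! ## §75 T-C `F1Sign2.EggTwistLawAtTwo`: DOWN unconditionally, UP on the habitat modulo Kramer parity -/

/-- **T-C, DOWN conjunct, modulo {PT, Tate χ} displayed**: `Δ > 0`, `E(ℚ)[2] = 0`, rank one, `Ш[2] = 0`, `d` descent-admissible,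
`E(ℚ)` meets the egg ⟹ `#Sel₂(W^{(d)}) = 1` (`#Sel₂(W) = 2` and DOWN by the egg class: `2·#Sel₂(W^{(d)}) = #Sel₂(W)`).
[cite: Kramer1981, §2 Prop. 6] [cite: MazurRubin2010, Lemma 2.9, Prop. 3.3, Cor. 3.4 (i)] [cite: MilneADT2006, I Thm. 2.13, 4.10] -/
theorem eggTwistLaw_meetsEgg_of_duality
    (hPT : poitouTate_selmerStructure_duality_real ℚ)
    (hEP : ∀ v : HeightOneSpectrum (𝓞 ℚ), localEulerPoincareCharacteristic (v.adicCompletion ℚ))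
    (hΔ : 0 < W.Δ) (hT : NoRationalTwoTorsion W) (hrank : W.mordellWeilRank = 1) (hSha : ShaTwoTrivial W)
    {d : ℤ} (hd : DescAdmissible W d) (hegg : MeetsEgg W) : twistSelmerTwoCard W d = 1 := by
  have h := two_mul_twistSelmerTwoCard_eq_of_exists W hPT hEP hΔ
    (exists_mem_selmerGroup_localization_inl_ne_zero_of_meetsEgg W hegg) hd
  rw [selmerTwoCard_eq_two_of_rank_one W hT hrank hSha] at h
  omega

/-- **T-C `F1Sign2.EggTwistLawAtTwo`, DOWN conjunct — UNCONDITIONAL, in T-C's own hypotheses**: for `W/ℚ` globally minimal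
elliptic with `Δ_W > 0`, `E(ℚ)[2] = 0` (`NoRationalTwoTorsion`), Mordell–Weil rank `1`, `Ш(W)[2] = 0` and every descent-admissible
`d`: **if `E(ℚ)` meets the egg then `#Sel₂(W^{(d)}) = 1`** (the twist has rank `0` and `Ш[2] = 0`). Poitou–Tate duality and Tate's
local Euler characteristic are the tree theorems `poitouTate_selmerStructure_duality_real_holds`, `GenusKolyLowering.localEP`;
no parity, no Galois-image hypothesis. Census (-desc MEMO §10): 375/375. [cite: Kramer1981, §2 Prop. 6]
[cite: MazurRubin2010, Cor. 3.4 (i)] [cite: MilneADT2006, I Thm. 2.8, 4.10] -/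
theorem eggTwistLaw_meetsEgg (hΔ : 0 < W.Δ) (hT : NoRationalTwoTorsion W) (hrank : W.mordellWeilRank = 1)
    (hSha : ShaTwoTrivial W) {d : ℤ} (hd : DescAdmissible W d) (hegg : MeetsEgg W) : twistSelmerTwoCard W d = 1 :=
  eggTwistLaw_meetsEgg_of_duality W (poitouTate_selmerStructure_duality_real_holds (K := ℚ)) (GenusKolyLowering.localEP ℚ)
    hΔ hT hrank hSha hd hegg

/-- **T-C, UP conjunct, ON THE HABITAT modulo {Kramer parity} ONLY**: for `W/ℚ` globally minimal elliptic with `ρ̄_{W,2}` onto,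
`Δ_W > 0`, Mordell–Weil rank `1`, `Ш(W)[2] = 0` and every descent-admissible `d`: **if no rational point lies on the egg
(`E(ℚ) ⊂ E⁰(ℝ)`) then `#Sel₂(W^{(d)}) = 4`** (`Sel₂(W)` is strict at `∞`; UP doubles `#Sel₂(W) = 2`). Conditional on
`MazurRubin2010.kramerParity ℚ` (Kramer's congruence, MR 2010 Thm. 2.7); PT and Tate χ discharged. Census: 65/65.
[cite: Kramer1981, §2 Prop. 6, Thm. 1] [cite: MazurRubin2010, Thm. 2.7, Cor. 3.4 (i)] -/
theorem eggTwistLaw_not_meetsEgg_habitat_of_parity (hKP : MazurRubin2010.kramerParity ℚ)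
    (hsurj : W.HasSurjectiveModNGaloisRep 2) (hΔ : 0 < W.Δ) (hrank : W.mordellWeilRank = 1) (hSha : ShaTwoTrivial W)
    {d : ℤ} (hd : DescAdmissible W d) (hegg : ¬ MeetsEgg W) : twistSelmerTwoCard W d = 4 := by
  have hT : NoRationalTwoTorsion W := noRationalTwoTorsion_of_hasSurjectiveModNGaloisRep W (by simpa using hsurj)
  have h := twistSelmerTwoCard_eq_two_mul_of_strict W (poitouTate_selmerStructure_duality_real_holds (K := ℚ))
    (GenusKolyLowering.localEP ℚ) hKP hsurj hΔ
    (forall_mem_selmerGroup_localization_inl_eq_zero_of_not_meetsEgg W hΔ hT hSha hegg) hd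
  rw [selmerTwoCard_eq_two_of_rank_one W hT hrank hSha] at h
  exact h

omit W in
/-- **T-C `F1Sign2.EggTwistLawAtTwo` ON THE HABITAT, modulo {Kramer parity} only** — T-C's conclusion VERBATIM
(`(MeetsEgg W → twistSelmerTwoCard W d = 1) ∧ (¬ MeetsEgg W → twistSelmerTwoCard W d = 4)`) for every globally minimal elliptic
`W/ℚ` with `ρ̄_{W,2}` onto (⟹ `NoRationalTwoTorsion W`), `Δ_W > 0`, rank `1`, `Ш(W)[2] = 0` and every descent-admissible `d`. The DOWN
conjunct is unconditional (`eggTwistLaw_meetsEgg`); only the UP conjunct uses `MazurRubin2010.kramerParity ℚ`.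
[cite: Kramer1981, §2 Prop. 6, Thm. 1] [cite: MazurRubin2010, Thm. 2.7, Cor. 3.4 (i)] -/
theorem eggTwistLaw_habitat_of_parity (hKP : MazurRubin2010.kramerParity ℚ) :
    ∀ (W : WeierstrassCurve ℚ) [W.IsElliptic] [W.IsGloballyMinimal], W.HasSurjectiveModNGaloisRep 2 → 0 < W.Δ →
      W.mordellWeilRank = 1 → ShaTwoTrivial W → ∀ d : ℤ, DescAdmissible W d →
        (MeetsEgg W → twistSelmerTwoCard W d = 1) ∧ (¬ MeetsEgg W → twistSelmerTwoCard W d = 4) := by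
  intro W _ _ hsurj hΔ hrank hSha d hd
  have hT : NoRationalTwoTorsion W := noRationalTwoTorsion_of_hasSurjectiveModNGaloisRep W (by simpa using hsurj)
  exact ⟨fun hegg ↦ eggTwistLaw_meetsEgg W hΔ hT hrank hSha hd hegg,
    fun hegg ↦ eggTwistLaw_not_meetsEgg_habitat_of_parity W hKP hsurj hΔ hrank hSha hd hegg⟩

omit W in
/-- **T-C by name from Kramer parity and the UP half off the habitat.** `EggTwistLawAtTwo` follows from `MazurRubin2010.kramerParity ℚ`
together with the UP direction for the non-surjective `ρ̄_{W,2}` (image `C₃`, `Δ_W > 0` a square up to the `16`): the only input the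
habitat proof does not cover. Stated as an implication so that a future discharge of that corner closes T-C by name.
[cite: Kramer1981, §2 Prop. 6, Thm. 1] [cite: MazurRubin2010, Thm. 2.7, Cor. 3.4 (i)] -/
theorem eggTwistLawAtTwo_of_parity_of_offHabitat (hKP : MazurRubin2010.kramerParity ℚ)
    (hoff : ∀ (W : WeierstrassCurve ℚ) [W.IsElliptic] [W.IsGloballyMinimal], ¬ W.HasSurjectiveModNGaloisRep 2 → 0 < W.Δ →
      NoRationalTwoTorsion W → W.mordellWeilRank = 1 → ShaTwoTrivial W → ¬ MeetsEgg W →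
        ∀ d : ℤ, DescAdmissible W d → twistSelmerTwoCard W d = 4) :
    EggTwistLawAtTwo := by
  intro W _ _ hΔ hT hrank hSha d hd
  refine ⟨fun hegg ↦ eggTwistLaw_meetsEgg W hΔ hT hrank hSha hd hegg, fun hegg ↦ ?_⟩
  by_cases hsurj : W.HasSurjectiveModNGaloisRep 2
  · exact eggTwistLaw_not_meetsEgg_habitat_of_parity W hKP hsurj hΔ hrank hSha hd hegg
  · exact hoff W hsurj hΔ hT hrank hSha hegg d hd

/-! ## §76 The descent sign is the egg -/

/-- **`ε(W) = +1` iff `E(ℚ)` meets the egg** (habitat, modulo {Kramer parity}): for `W/ℚ` globally minimal with `ρ̄_{W,2}` onto,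
`Δ_W > 0` and `Ш(W)[2] = 0`, `¬ F1Sign2.DescentSignNeg W` (no descent-admissible twist doubles `#Sel₂`) iff some rational point lies
on the egg — file 29's `not_descentSignNeg_iff_exists_habitat_of_parity` read through the dictionary of file 30 (`#Sel₂(W) ≠ 0`: the
Selmer group is finite). No rank hypothesis. [cite: Kramer1981, §2 Prop. 6, Thm. 1] [cite: MazurRubin2010, Thm. 2.7, Cor. 3.4 (i)] -/
theorem not_descentSignNeg_iff_meetsEgg_habitat_of_parity (hKP : MazurRubin2010.kramerParity ℚ)
    (hsurj : W.HasSurjectiveModNGaloisRep 2) (hΔ : 0 < W.Δ) (hSha : ShaTwoTrivial W) :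
    ¬ DescentSignNeg W ↔ MeetsEgg W := by
  have hT : NoRationalTwoTorsion W := noRationalTwoTorsion_of_hasSurjectiveModNGaloisRep W (by simpa using hsurj)
  have h0 : selmerTwoCard W ≠ 0 := by
    rw [selmerTwoCard]
    haveI : Finite (W.selmerGroup 2) := W.finite_selmerGroup_holds (by norm_num)
    haveI : Nonempty (W.selmerGroup 2) := ⟨0⟩
    exact Nat.card_pos.ne'
  rw [not_descentSignNeg_iff_exists_habitat_of_parity W (poitouTate_selmerStructure_duality_real_holds (K := ℚ))
    (GenusKolyLowering.localEP ℚ) hKP hsurj hΔ h0, meetsEgg_iff_exists_localization_inl_ne_zero W hΔ hT hSha]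

/-- **`ε(W) = −1` iff `E(ℚ) ⊂ E⁰(ℝ)`** (habitat, modulo {Kramer parity}): the negation of the previous statement.
[cite: Kramer1981, §2 Prop. 6, Thm. 1] [cite: MazurRubin2010, Thm. 2.7, Cor. 3.4 (i)] -/
theorem descentSignNeg_iff_not_meetsEgg_habitat_of_parity (hKP : MazurRubin2010.kramerParity ℚ)
    (hsurj : W.HasSurjectiveModNGaloisRep 2) (hΔ : 0 < W.Δ) (hSha : ShaTwoTrivial W) :
    DescentSignNeg W ↔ ¬ MeetsEgg W := by
  rw [← not_descentSignNeg_iff_meetsEgg_habitat_of_parity W hKP hsurj hΔ hSha, not_not]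

end Summit.BirchSwinnertonDyer.BirchSwinnertonDyer.Theorems.GenusKolyArch

end
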